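import Mathlib
import Literature.Analysis.FluidPDE.ClassicalSolution
import Literature.Analysis.FluidPDE.LerayHopf
import Literature.Analysis.FluidPDE.LerayHopfProofs
import Literature.Analysis.FluidPDE.NSVorticity
import Literature.Analysis.FluidPDE.TaoLocalisation
import Literature.Analysis.FluidPDE.TaoLocalisationHolds
import Literature.Analysis.FluidPDE.TaoLocalisationProofs
import Literature.Analysis.FluidPDE.TaoEnstrophyLocalisation
import Literature.Analysis.FluidPDE.AxisymmetricNoSwirlWeightedEnstrophyProofs
import Summits.NavierStokesRegularity.NavierStokesRegularity.Theorems.PlaneEnergyCeilingPlanarEnergyAPrioriClosedSlab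
import Summits.NavierStokesRegularity.NavierStokesRegularity.Theses.L3TimeExponentPincer
import HarnessLib.Audit
import HarnessLib

/-!
# The `L³`-effective node `K₃(σ)` of crux `L3CascadeJaw` (route `L3TimeExponentPincer`), its exchange-rate chain, and
# the statements of the two stubs of line `EffSat`

Support file for `stmt-NavierStokesRegularity-19499` (cell ns-regularity-ideate, seat p2, ROUND-6/7; source of record:
`run/shared/lean/pub/ns-regularity-ideate/ns-regularity-ideate-p2/EffLadder.lean`, `SmoothBranch.lean`).

* `EffSaturatesAt σ u T` — the node `K₃(σ)`: at every late time some `U ≥ 0` with `‖u(t)‖₃³ ≤ L·U` carries a FAT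
  ball (`m U² r³ ≤ ∫_{B_r}|u|²`) of radius `r ≥ R₀ U^{2σ-1} (T-t)^σ` (the causal scale of the effective speed);
  `EffScaleSaturation σ` / `EffScaleSaturationB σ` — over the whole frame / on the blow-up branch.
* `speed_le_of_fat`, `l3Rate_of_effSaturatesAt`, `jaw_of_effSaturatesAt` — fat ball + energy bound ⇒ effective speed
  `≤ C (T-t)^{-3σ/(6σ-1)}` ⇒ `‖u(t)‖₃ ≤ K (T-t)^{-σ/(6σ-1)}` ⇒ `∫ ‖u‖₃^q < ∞` for `q < q(σ) = (6σ-1)/σ`.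
* `EffSatBlowup` — VERBATIM statement of the hard stub `stub_effSaturation_blowup` of `Lines/effsat.lean` (the M-stub `JawSmoothBranch` is stated and PROVED in the companion file); `JawBlowupBranch`.

0 `sorry`.  The companion file `L3TimeExponentPincerSmoothBranch.lean` proves `JawSmoothBranch`, `K₃(1)` on the smooth
branch, and the one-stub composition `EffSatBlowup → L3CascadeJaw`.
-/

noncomputable section

namespace Summit.NavierStokesRegularity.NavierStokesRegularity.Theorems.L3TimeExponentPincerEffNode

open MeasureTheory Set Filter Metric Function Topology
open scoped ENNReal NNReal Topology
open Literature.Analysis.FluidPDE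


/-! ## §0  VERBATIM from `EffLadder.lean` (ROUND-6): helpers, the node `K₃(σ)`, the `K₃ ⇒ jaw` chain -/

/-- `∫_a^T c (T-s)^r ds < ∞` for `r > -1` (verbatim `Ladder.lean`). -/
theorem lintegral_Ioo_ofReal_mul_rpow_lt_top {a T : ℝ} (haT : a < T) (c r : ℝ) (hr : -1 < r) :
    (∫⁻ s in Ioo a T, ENNReal.ofReal (c * (T - s) ^ r)) < ⊤ := by
  have h1 : IntervalIntegrable (fun s : ℝ => s ^ r) volume 0 (T - a) :=
    intervalIntegral.intervalIntegrable_rpow' hr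
  have h2 : IntervalIntegrable (fun s : ℝ => (T - s) ^ r) volume a T := by
    have := (h1.comp_sub_left T).symm
    simpa only [sub_zero, sub_sub_cancel] using this
  have h3 : IntegrableOn (fun s : ℝ => c * (T - s) ^ r) (Ioo a T) volume :=
    ((intervalIntegrable_iff_integrableOn_Ioo_of_le haT.le).1 h2).const_mul c
  exact lt_of_le_of_lt (lintegral_mono fun s => Real.ofReal_le_enorm _) h3.2

/-- A rate bound `‖u(t)‖₃ ≤ K (T-t)^{-θ}` on `[T₂,T)` with `qθ < 1` gives `∫_{T₂}^T ‖u‖₃^q < ∞`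
(verbatim `Ladder.lean`). -/
theorem l3Hypothesis_of_rate {T T₂ K θ q : ℝ} (hT₂T : T₂ < T) (hq : 0 ≤ q) (hqθ : q * θ < 1)
    (hK : 0 ≤ K) {u : ℝ → (EuclideanSpace ℝ (Fin 3)) → (EuclideanSpace ℝ (Fin 3))}
    (h : ∀ t ∈ Ico T₂ T, eLpNorm (u t) 3 volume ≤ ENNReal.ofReal (K * (T - t) ^ (-θ))) :
    (∫⁻ t in Ioo T₂ T, eLpNorm (u t) 3 volume ^ q) < ⊤ := by
  have hpt : ∀ t ∈ Ioo T₂ T,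
      eLpNorm (u t) 3 volume ^ q ≤ ENNReal.ofReal (K ^ q * (T - t) ^ (-(q * θ))) := by
    intro t ht
    have hTt : 0 < T - t := by linarith [ht.2]
    calc eLpNorm (u t) 3 volume ^ q ≤ ENNReal.ofReal (K * (T - t) ^ (-θ)) ^ q :=
          ENNReal.rpow_le_rpow (h t ⟨ht.1.le, ht.2⟩) hq
      _ = ENNReal.ofReal (K ^ q * (T - t) ^ (-(q * θ))) := by
          rw [ENNReal.ofReal_rpow_of_nonneg (mul_nonneg hK (Real.rpow_nonneg hTt.le _)) hq,
            Real.mul_rpow hK (Real.rpow_nonneg hTt.le _), ← Real.rpow_mul hTt.le]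
          congr 3
          ring
  refine lt_of_le_of_lt
    (lintegral_mono_ae ((ae_restrict_mem measurableSet_Ioo).mono fun t ht => hpt t ht)) ?_
  exact lintegral_Ioo_ofReal_mul_rpow_lt_top hT₂T _ _ (by linarith)


/-- Roots: `U^e · s^f ≤ M` with `e > 0`, `s > 0` gives `U ≤ M^{1/e} · s^{-(f/e)}` (verbatim `Ladder.lean`). -/
theorem le_rpow_of_rpow_mul_rpow_le {U s M e f : ℝ} (hU : 0 ≤ U) (hM : 0 ≤ M) (hs : 0 < s)
    (he : 0 < e) (h : U ^ e * s ^ f ≤ M) : U ≤ M ^ (1 / e) * s ^ (-(f / e)) := by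
  have hsf : 0 < s ^ f := Real.rpow_pos_of_pos hs f
  have h1 : U ^ e ≤ M * s ^ (-f) := by
    rw [Real.rpow_neg hs.le, ← div_eq_mul_inv, le_div_iff₀ hsf]; exact h
  have h2 : (U ^ e) ^ (1 / e) ≤ (M * s ^ (-f)) ^ (1 / e) :=
    Real.rpow_le_rpow (Real.rpow_nonneg hU e) h1 (by positivity)
  have h3 : (U ^ e) ^ (1 / e) = U := by
    rw [← Real.rpow_mul hU, show e * (1 / e) = 1 by field_simp, Real.rpow_one]
  have hexp : -f * (1 / e) = -(f / e) := by ring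
  rw [h3, Real.mul_rpow hM (Real.rpow_nonneg hs.le _), ← Real.rpow_mul hs.le, hexp] at h2
  exact h2


/-- **The real-algebra core of the ladder** (factored out of ROUND-5 `supRate_of_saturatesAt`): a ball of
radius `r ≥ ρ_σ = R₀ U^{2σ-1} s^σ` carrying energy `m U² r³ ≤ E` forces `U ≤ (E/(m R₀³))^{1/(6σ-1)} s^{-3σ/(6σ-1)}`
(`σ > 1/6`, `U, s > 0`).  It never looks at what `U` bounds — this is why the de-rating of §B–§D is free. -/
theorem speed_le_of_fat {σ m R₀ E U s r : ℝ} (hσ : 1 / 6 < σ) (hm : 0 < m) (hR₀ : 0 < R₀)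
    (hU : 0 < U) (hs : 0 < s) (hr : R₀ * U ^ (2 * σ - 1) * s ^ σ ≤ r)
    (hfat : m * (U ^ 2 * r ^ 3) ≤ E) :
    U ≤ (E / (m * R₀ ^ 3)) ^ (1 / (6 * σ - 1)) * s ^ (-(3 * σ / (6 * σ - 1))) := by
  have he : 0 < 6 * σ - 1 := by linarith
  set ρ : ℝ := R₀ * U ^ (2 * σ - 1) * s ^ σ with hρ
  have hρpos : 0 < ρ := by positivity
  have hr0 : 0 < r := lt_of_lt_of_le hρpos hr
  have hE : 0 ≤ E := le_trans (by positivity) hfat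
  have hρr : ρ ^ 3 ≤ r ^ 3 := pow_le_pow_left₀ hρpos.le hr 3
  have h1 : m * (U ^ 2 * ρ ^ 3) ≤ E := le_trans (by gcongr) hfat
  have hU2 : U ^ 2 * (U ^ (2 * σ - 1)) ^ 3 = U ^ (6 * σ - 1) := by
    rw [← Real.rpow_natCast (U ^ (2 * σ - 1)) 3, ← Real.rpow_mul hU.le,
      ← Real.rpow_natCast U 2, ← Real.rpow_add hU]
    congr 1
    push_cast
    ring
  have hs3 : (s ^ σ) ^ 3 = s ^ (3 * σ) := by
    rw [← Real.rpow_natCast (s ^ σ) 3, ← Real.rpow_mul hs.le]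
    congr 1
    push_cast
    ring
  have hUρ : U ^ 2 * ρ ^ 3 = R₀ ^ 3 * (U ^ (6 * σ - 1) * s ^ (3 * σ)) := by
    rw [hρ, mul_pow, mul_pow, ← hs3, ← hU2]
    ring
  have h2 : U ^ (6 * σ - 1) * s ^ (3 * σ) ≤ E / (m * R₀ ^ 3) := by
    rw [le_div_iff₀ (by positivity)]
    calc U ^ (6 * σ - 1) * s ^ (3 * σ) * (m * R₀ ^ 3) = m * (U ^ 2 * ρ ^ 3) := by
          rw [hUρ]; ring
      _ ≤ E := h1
  exact le_rpow_of_rpow_mul_rpow_le hU.le (by positivity) hs he h2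


/-- **NEW — K₃(σ) for one field near `T` (effective-speed saturation).**  There are `m, R₀, L > 0` and a
final window on which, at each time, SOME number `U ≥ 0` with `‖u(t)‖₃³ ≤ L · U` (an `L³`-EFFECTIVE SPEED:
for a Leray–Hopf field `‖u‖₃³ ≤ ‖u‖_∞ ‖u‖₂²`, so every pointwise bound qualifies with `L = 2E(u₀)`), SOME centre
and SOME radius `r ≥ ρ_σ = R₀ U^{2σ-1} (T-t)^σ` satisfy `m U² r³ ≤ ∫_{B(x₀,r)} |u(t)|²`.  No pointwise
information about `u` is demanded: a thin fast spike riding on a fat slow structure is invisible to K₃ exactly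
as it is invisible to the door `∫ ‖u‖₃^q`. -/
def EffSaturatesAt (σ : ℝ) (u : ℝ → (EuclideanSpace ℝ (Fin 3)) → (EuclideanSpace ℝ (Fin 3))) (T : ℝ) : Prop :=
  ∃ m : ℝ, 0 < m ∧ ∃ R₀ : ℝ, 0 < R₀ ∧ ∃ L : ℝ, 0 < L ∧ ∃ T₁ < T, ∀ t ∈ Ioo T₁ T,
    ∃ U : ℝ, 0 ≤ U ∧ eLpNorm (u t) 3 volume ^ (3 : ℝ) ≤ ENNReal.ofReal (L * U) ∧
      ∃ x₀ : (EuclideanSpace ℝ (Fin 3)), ∃ r : ℝ,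
        R₀ * U ^ (2 * σ - 1) * (T - t) ^ σ ≤ r ∧
        ENNReal.ofReal (m * (U ^ 2 * r ^ 3)) ≤ ∫⁻ x in ball x₀ r, ‖u t x‖ₑ ^ 2

/-- **K₃(σ) over the route's frame** (verbatim the frame of `L3CascadeJaw`). -/
@[conjecture] def EffScaleSaturation (σ : ℝ) : Prop :=
  ∀ (ν T : ℝ), 0 < ν → 0 < T → ∀ (u : ℝ → (EuclideanSpace ℝ (Fin 3)) → (EuclideanSpace ℝ (Fin 3))) (p : ℝ → (EuclideanSpace ℝ (Fin 3)) → ℝ),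
    IsClassicalNSSolutionOn (Ico 0 T) ν 0 u p → IsLerayHopfOn T ν 0 (u 0) u →
    HasRapidSpatialDecay (u 0) → EffSaturatesAt σ u T

/-- **K₃(σ) on the BLOW-UP BRANCH only**: demanded of frame solutions that do NOT extend past `T`
(maximal solutions).  On this branch the Leray floor `|u(t,x_t)|²(T-t) ≥ c₀` is a THEOREM (§F). -/
@[conjecture] def EffScaleSaturationB (σ : ℝ) : Prop :=
  ∀ (ν T : ℝ), 0 < ν → 0 < T → ∀ (u : ℝ → (EuclideanSpace ℝ (Fin 3)) → (EuclideanSpace ℝ (Fin 3))) (p : ℝ → (EuclideanSpace ℝ (Fin 3)) → ℝ),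
    IsClassicalNSSolutionOn (Ico 0 T) ν 0 u p → IsLerayHopfOn T ν 0 (u 0) u →
    HasRapidSpatialDecay (u 0) → ¬ HasSmoothExtensionPast ν 0 u T → EffSaturatesAt σ u T


/-- exchange rate of the ladder: `q(σ) = (6σ-1)/σ = 6 - 1/σ` (verbatim `Ladder.lean`). -/
def qOfSigma (σ : ℝ) : ℝ := (6 * σ - 1) / σ


/-- `q(1) = 5`. -/
theorem qOfSigma_one : qOfSigma 1 = 5 := by norm_num [qOfSigma]


/-! ### (verbatim `EffLadder.lean` §D)  `K₃(σ)` + energy inequality ⇒ the `L³`-rate `σ/(6σ-1)` ⇒ the jaw -/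

/-- **K₃(σ) ⇒ `L³`-rate.**  For a Leray–Hopf solution (`ν > 0`, `f = 0`) with `EffSaturatesAt σ u T`,
`σ > 1/6`: `‖u(t)‖₃ ≤ K (T-t)^{-σ/(6σ-1)}` on a final window `(T₁,T)`, `T₁ ≥ 0`, with
`K = (L · (2E(u₀)/(m R₀³))^{1/(6σ-1)})^{1/3}`.  No sup-norm rate is produced or used. -/
theorem l3Rate_of_effSaturatesAt {σ ν T : ℝ} (hσ : 1 / 6 < σ) (hν : 0 < ν) (hT : 0 < T)
    {u : ℝ → (EuclideanSpace ℝ (Fin 3)) → (EuclideanSpace ℝ (Fin 3))} (hLH : IsLerayHopfOn T ν 0 (u 0) u) (hK : EffSaturatesAt σ u T) :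
    ∃ K : ℝ, 0 ≤ K ∧ ∃ T₁ : ℝ, 0 ≤ T₁ ∧ T₁ < T ∧ ∀ t ∈ Ioo T₁ T,
      eLpNorm (u t) 3 volume ≤ ENNReal.ofReal (K * (T - t) ^ (-(σ / (6 * σ - 1)))) := by
  obtain ⟨m, hm, R₀, hR₀, L, hL, T₁, hT₁T, hwin⟩ := hK
  set E2 : ℝ := 2 * VectorCalculus.kineticEnergy (u 0) with hE2
  have hE2nn : 0 ≤ E2 :=
    mul_nonneg zero_le_two (Literature.Analysis.FluidPDE.kineticEnergy_nonneg _)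
  have he : 0 < 6 * σ - 1 := by linarith
  set K₀ : ℝ := (E2 / (m * R₀ ^ 3)) ^ (1 / (6 * σ - 1)) with hK₀def
  have hK₀ : 0 ≤ K₀ := Real.rpow_nonneg (by positivity) _
  refine ⟨(L * K₀) ^ (1 / 3 : ℝ), by positivity, max T₁ 0, le_max_right _ _, max_lt hT₁T hT,
    fun t ht => ?_⟩
  have ht₁ : t ∈ Ioo T₁ T := ⟨lt_of_le_of_lt (le_max_left _ _) ht.1, ht.2⟩
  have ht0 : t ∈ Icc 0 T := ⟨(le_max_right T₁ 0).trans ht.1.le, ht.2.le⟩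
  have hs : 0 < T - t := sub_pos.2 ht.2
  obtain ⟨U, hU0, hU3, x₀, r, hr, hloc⟩ := hwin t ht₁
  -- Step 1: the effective speed obeys the σ-rate.
  have hUrate : U ≤ K₀ * (T - t) ^ (-(3 * σ / (6 * σ - 1))) := by
    rcases hU0.eq_or_lt with hU | hU
    · rw [← hU]; positivity
    have hglob : ∫⁻ y in ball x₀ r, ‖u t y‖ₑ ^ 2 ≤ ENNReal.ofReal E2 :=
      (setLIntegral_le_lintegral _ _).trans (hLH.lintegral_enorm_sq_le hν.le ht0)
    have hreal : m * (U ^ 2 * r ^ 3) ≤ E2 :=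
      (ENNReal.ofReal_le_ofReal_iff hE2nn).1 (hloc.trans hglob)
    exact speed_le_of_fat hσ hm hR₀ hU hs hr hreal
  -- Step 2: `‖u(t)‖₃³ ≤ L U ≤ L K₀ (T-t)^{-3σ/(6σ-1)}`; take cube roots.
  have h3 : eLpNorm (u t) 3 volume ^ (3 : ℝ) ≤
      ENNReal.ofReal (L * K₀ * (T - t) ^ (-(3 * σ / (6 * σ - 1)))) :=
    hU3.trans (ENNReal.ofReal_le_ofReal
      ((mul_le_mul_of_nonneg_left hUrate hL.le).trans_eq (mul_assoc _ _ _).symm))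
  have hroot : eLpNorm (u t) 3 volume = (eLpNorm (u t) 3 volume ^ (3 : ℝ)) ^ (1 / 3 : ℝ) := by
    rw [← ENNReal.rpow_mul]; norm_num
  calc eLpNorm (u t) 3 volume = (eLpNorm (u t) 3 volume ^ (3 : ℝ)) ^ (1 / 3 : ℝ) := hroot
    _ ≤ (ENNReal.ofReal (L * K₀ * (T - t) ^ (-(3 * σ / (6 * σ - 1))))) ^ (1 / 3 : ℝ) :=
        ENNReal.rpow_le_rpow h3 (by norm_num)
    _ = ENNReal.ofReal ((L * K₀) ^ (1 / 3 : ℝ) * (T - t) ^ (-(σ / (6 * σ - 1)))) := by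
        rw [ENNReal.ofReal_rpow_of_nonneg (by positivity) (by norm_num),
          Real.mul_rpow (by positivity) (Real.rpow_nonneg hs.le _), ← Real.rpow_mul hs.le]
        congr 3
        ring

/-- **K₃(σ) for one Leray–Hopf field ⇒ the jaw for every `q ∈ [0, q(σ))`.** -/
theorem jaw_of_effSaturatesAt {σ ν T : ℝ} (hσ : 1 / 6 < σ) (hν : 0 < ν) (hT : 0 < T)
    {u : ℝ → (EuclideanSpace ℝ (Fin 3)) → (EuclideanSpace ℝ (Fin 3))} (hLH : IsLerayHopfOn T ν 0 (u 0) u) (hK : EffSaturatesAt σ u T)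
    {q : ℝ} (hq0 : 0 ≤ q) (hq : q < qOfSigma σ) :
    ∃ T₂ ∈ Ioo 0 T, (∫⁻ t in Ioo T₂ T, eLpNorm (u t) 3 volume ^ q) < ⊤ := by
  obtain ⟨K, hK, T₁, hT₁0, hT₁T, hrate⟩ := l3Rate_of_effSaturatesAt hσ hν hT hLH hK
  set T₂ : ℝ := (T₁ + T) / 2 with hT₂
  have hT₂1 : T₁ < T₂ := by rw [hT₂]; linarith
  have hT₂T : T₂ < T := by rw [hT₂]; linarith
  have hT₂0 : 0 < T₂ := lt_of_le_of_lt hT₁0 hT₂1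
  refine ⟨T₂, ⟨hT₂0, hT₂T⟩, ?_⟩
  have hσ0 : 0 < σ := by linarith
  have he : 0 < 6 * σ - 1 := by linarith
  have hqθ : q * (σ / (6 * σ - 1)) < 1 := by
    unfold qOfSigma at hq
    rw [lt_div_iff₀ hσ0] at hq
    rw [show q * (σ / (6 * σ - 1)) = q * σ / (6 * σ - 1) by ring, div_lt_iff₀ he]
    linarith
  exact l3Hypothesis_of_rate hT₂T hq0 hqθ hK fun t ht => hrate t ⟨lt_of_lt_of_le hT₂1 ht.1, ht.2⟩


/-! ## §1  The statements of the two stubs of line `EffSat`, VERBATIM, and the blow-up half of the crux -/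


/-- VERBATIM the statement of `stub_effSaturation_blowup` (`route/LineEffSat.lean`): `K₃(1)` on the blow-up
branch, the scale clause spelled `R₀ · U · (T - t) ≤ r`. -/
@[conjecture] def EffSatBlowup : Prop :=
  ∀ (ν T : ℝ), 0 < ν → 0 < T → ∀ (u : ℝ → (EuclideanSpace ℝ (Fin 3)) → (EuclideanSpace ℝ (Fin 3))) (p : ℝ → (EuclideanSpace ℝ (Fin 3)) → ℝ),
    IsClassicalNSSolutionOn (Ico 0 T) ν 0 u p → IsLerayHopfOn T ν 0 (u 0) u →
    HasRapidSpatialDecay (u 0) → ¬ HasSmoothExtensionPast ν 0 u T →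
    ∃ m : ℝ, 0 < m ∧ ∃ R₀ : ℝ, 0 < R₀ ∧ ∃ L : ℝ, 0 < L ∧ ∃ T₁ < T, ∀ t ∈ Ioo T₁ T,
      ∃ U : ℝ, 0 ≤ U ∧ eLpNorm (u t) 3 volume ^ (3 : ℝ) ≤ ENNReal.ofReal (L * U) ∧
        ∃ x₀ : (EuclideanSpace ℝ (Fin 3)), ∃ r : ℝ, R₀ * U * (T - t) ≤ r ∧
          ENNReal.ofReal (m * (U ^ 2 * r ^ 3)) ≤ ∫⁻ x in ball x₀ r, ‖u t x‖ₑ ^ 2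

/-- The BLOW-UP-BRANCH half of the crux `L3CascadeJaw`: the jaw demanded only of frame solutions that do not
extend smoothly past `T`. -/
@[conjecture] def JawBlowupBranch : Prop :=
  ∀ q : ℝ, 4 < q → q < 5 → ∀ (ν T : ℝ), 0 < ν → 0 < T → ∀ (u : ℝ → (EuclideanSpace ℝ (Fin 3)) → (EuclideanSpace ℝ (Fin 3))) (p : ℝ → (EuclideanSpace ℝ (Fin 3)) → ℝ),
    IsClassicalNSSolutionOn (Ico 0 T) ν 0 u p → IsLerayHopfOn T ν 0 (u 0) u →
    HasRapidSpatialDecay (u 0) → ¬ HasSmoothExtensionPast ν 0 u T →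
    ∃ T₂ ∈ Ioo 0 T, (∫⁻ t in Ioo T₂ T, eLpNorm (u t) 3 volume ^ q) < ⊤

end Summit.NavierStokesRegularity.NavierStokesRegularity.Theorems.L3TimeExponentPincerEffNode

end
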